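import Mathlib.RingTheory.PowerSeries.Derivative
import Mathlib.RingTheory.PowerSeries.Substitution
import Mathlib.NumberTheory.Padics.PadicNumbers
import Mathlib.Analysis.SpecificLimits.Basic
import Mathlib.Analysis.SpecialFunctions.Pow.Real
import Mathlib.Analysis.Normed.Group.InfiniteSum
import HarnessLib

/-!
# Denominators of the inverse of a power series `Σ aₙ Tⁿ/n!` and `p`-adic convergence of such
# series (Silverman AEC IV.5.4, IV.6.2, IV.6.3(b))

Trunk T-NT-EC (Literature/NumberTheory/EllipticCurves); general power-series input for the
discharge of `WeierstrassCurve.summable_formalExp` (AEC IV.6.4(b) for the formal group `Ê` of a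
Weierstrass curve, `FormalGroupProofs.lean`). Nothing here mentions elliptic curves.

* `factorial_mul_coeff_mem_of_subst_eq_X` — **AEC IV.5.4**: let `S` be a subring of a
  commutative ring `K` and `f = Σ_{n ≥ 1} (aₙ/n!) Tⁿ ∈ K⟦T⟧` with `aₙ ∈ S` (precisely:
  `n! · coeff n f ∈ S` for all `n`) and `a₁ ∈ Sˣ`. If `g ∈ K⟦T⟧`, `g(0) = 0`, satisfies
  `f(g(T)) = T`, then `g = Σ (bₙ/n!) Tⁿ` with `bₙ ∈ S`, i.e. `n! · coeff n g ∈ S`.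
  (Silverman states it for `R` torsion-free and `K = R ⊗ ℚ`; the proof — "repeated
  differentiation of `f(g(T)) = T` expresses `a₁ bₙ` as an integer polynomial in
  `a₁, …, aₙ, b₁, …, bₙ₋₁`" — needs neither hypothesis, and we drop both.)
  The bookkeeping device is the predicate `IsDerivConstIn S n f`: "`f, f', …, f⁽ⁿ⁾` have constant
  coefficients in `S`", equivalent to `k! · coeff k f ∈ S` for `k ≤ n` since
  `f⁽ᵏ⁾(0) = k! · coeff k f`; it is closed under sums, products, substitution (chain rule,
  Mathlib `PowerSeries.derivative_subst`) and division by a series whose constant term is a unit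
  of `S`, which is exactly what the inductive step `g' = 1/f'(g)` consumes.
* `padic_summable_of_norm_factorial_mul_le` — **AEC IV.6.2 + IV.6.3(b)** over `ℚ_p`
  (`v(p) = 1`): if `‖n! · cₙ‖_p ≤ 1` for all `n` and `‖t‖_p < p^{-1/(p-1)}` (i.e.
  `v(t) > 1/(p - 1)`), then `Σ cₙ tⁿ` converges; indeed `‖cₙ tⁿ‖ ≤ p^{v_p(n!)} ‖t‖ⁿ ≤
  (p^{1/(p-1)} ‖t‖)ⁿ` by Legendre's `(p - 1) v_p(n!) = n - s_p(n) ≤ n`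
  (Mathlib `sub_one_mul_padicValNat_factorial`), a convergent geometric bound.

## Sources

* J. H. Silverman, *The Arithmetic of Elliptic Curves*, 2nd ed., GTM 106 (2009), Lemma IV.5.4
  (p. 131), Lemma IV.6.2 and Lemma IV.6.3(b) (p. 133) (`SilvermanAEC2009`).

## Design notes

* We work with an arbitrary `Subring K` rather than a torsion-free `R ⊂ R ⊗ ℚ`; the consumer
  takes `K = ℚ_p`, `S = ℤ_p = PadicInt.subring p`.
* AEC IV.6.2 is used in the weak form `v_p(n!) ≤ n/(p-1)`, which is all IV.6.3(b) needs for
  convergence (the sharp `(n-1)/(p-1)` only matters for `v(g(x)) = v(x)`, not vendored here).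
-/

noncomputable section

open PowerSeries Nat

namespace Literature.NumberTheory.EllipticCurves

/-! ### `f, f', …, f⁽ⁿ⁾` have constant coefficients in `S` -/

section Denominators

variable {K : Type*} [CommRing K] (S : Subring K)

/-- `IsDerivConstIn S n f`: the power series `f, f', f'', …, f⁽ⁿ⁾ ∈ K⟦X⟧` all have constant
coefficient in the subring `S ⊆ K`; equivalently (`factorial_mul_coeff_mem`,
`isDerivConstIn_of_factorial_mul_coeff_mem`) `k! · coeff k f ∈ S` for all `k ≤ n`, i.e. `f` is
`Σ (bₖ/k!) Xᵏ` with `bₖ ∈ S` up to order `n` (the shape of series in AEC IV.5.4). Defined by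
recursion on `n` so that every closure property is a one-line induction. [folklore] -/
def IsDerivConstIn : ℕ → K⟦X⟧ → Prop
  | 0, f => constantCoeff f ∈ S
  | n + 1, f => constantCoeff f ∈ S ∧ IsDerivConstIn n (d⁄dX K f)

variable {S}

/-- Unfolding at `0`. [folklore] -/
@[simp] theorem isDerivConstIn_zero_iff (f : K⟦X⟧) :
    IsDerivConstIn S 0 f ↔ constantCoeff f ∈ S := Iff.rfl

/-- Unfolding at `n + 1`. [folklore] -/
@[simp] theorem isDerivConstIn_succ_iff (n : ℕ) (f : K⟦X⟧) :
    IsDerivConstIn S (n + 1) f ↔ constantCoeff f ∈ S ∧ IsDerivConstIn S n (d⁄dX K f) := Iff.rfl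

/-- The constant coefficient itself lies in `S`. [folklore] -/
theorem IsDerivConstIn.constantCoeff_mem {n : ℕ} {f : K⟦X⟧} (h : IsDerivConstIn S n f) :
    constantCoeff f ∈ S := by
  cases n with
  | zero => exact h
  | succ n => exact h.1

/-- Monotonicity in the order. [folklore] -/
theorem IsDerivConstIn.mono {n : ℕ} {f : K⟦X⟧} (h : IsDerivConstIn S (n + 1) f) :
    IsDerivConstIn S n f := by
  induction n generalizing f with
  | zero => exact h.1
  | succ n ih => exact ⟨h.1, ih h.2⟩

/-- `0` qualifies. [folklore] -/
theorem isDerivConstIn_zero (n : ℕ) : IsDerivConstIn S n (0 : K⟦X⟧) := by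
  induction n with
  | zero => simp
  | succ n ih => simpa [map_zero] using ih

/-- `1` qualifies. [folklore] -/
theorem isDerivConstIn_one (n : ℕ) : IsDerivConstIn S n (1 : K⟦X⟧) := by
  cases n with
  | zero => simp
  | succ n =>
    refine ⟨by simp, ?_⟩
    rw [Derivation.map_one_eq_zero]
    exact isDerivConstIn_zero n

/-- Constants from `S` qualify. [folklore] -/
theorem isDerivConstIn_C (n : ℕ) {c : K} (hc : c ∈ S) : IsDerivConstIn S n (C c) := by
  cases n with
  | zero => simpa using hc
  | succ n =>
    refine ⟨by simpa using hc, ?_⟩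
    rw [derivative_C]
    exact isDerivConstIn_zero n

/-- Natural-number constants qualify. [folklore] -/
theorem isDerivConstIn_natCast (n m : ℕ) : IsDerivConstIn S n (m : K⟦X⟧) := by
  rw [← map_natCast (C (R := K)) m]
  exact isDerivConstIn_C n (natCast_mem S m)

/-- The variable `X` qualifies. [folklore] -/
theorem isDerivConstIn_X (n : ℕ) : IsDerivConstIn S n (X : K⟦X⟧) := by
  cases n with
  | zero => simp
  | succ n =>
    refine ⟨by simp, ?_⟩
    rw [derivative_X]
    exact isDerivConstIn_one n

/-- Closure under addition. [folklore] -/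
theorem IsDerivConstIn.add {n : ℕ} {f g : K⟦X⟧} (hf : IsDerivConstIn S n f)
    (hg : IsDerivConstIn S n g) : IsDerivConstIn S n (f + g) := by
  induction n generalizing f g with
  | zero => simpa using S.add_mem hf hg
  | succ n ih =>
    refine ⟨by simpa using S.add_mem hf.1 hg.1, ?_⟩
    rw [map_add]
    exact ih hf.2 hg.2

/-- Closure under negation. [folklore] -/
theorem IsDerivConstIn.neg {n : ℕ} {f : K⟦X⟧} (hf : IsDerivConstIn S n f) :
    IsDerivConstIn S n (-f) := by
  induction n generalizing f with
  | zero => simpa using S.neg_mem hf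
  | succ n ih =>
    refine ⟨by simpa using S.neg_mem hf.1, ?_⟩
    rw [map_neg]
    exact ih hf.2

/-- Closure under subtraction. [folklore] -/
theorem IsDerivConstIn.sub {n : ℕ} {f g : K⟦X⟧} (hf : IsDerivConstIn S n f)
    (hg : IsDerivConstIn S n g) : IsDerivConstIn S n (f - g) := by
  rw [sub_eq_add_neg]
  exact hf.add hg.neg

/-- Closure under multiplication (Leibniz rule). [folklore] -/
theorem IsDerivConstIn.mul {n : ℕ} {f g : K⟦X⟧} (hf : IsDerivConstIn S n f)
    (hg : IsDerivConstIn S n g) : IsDerivConstIn S n (f * g) := by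
  induction n generalizing f g with
  | zero => simpa using S.mul_mem hf hg
  | succ n ih =>
    refine ⟨by simpa using S.mul_mem hf.1 hg.1, ?_⟩
    rw [Derivation.leibniz, smul_eq_mul, smul_eq_mul]
    exact (ih hf.mono hg.2).add (ih hg.mono hf.2)

/-- Closure under powers. [folklore] -/
theorem IsDerivConstIn.pow {n : ℕ} {f : K⟦X⟧} (hf : IsDerivConstIn S n f) (k : ℕ) :
    IsDerivConstIn S n (f ^ k) := by
  induction k with
  | zero => simpa using isDerivConstIn_one n
  | succ k ih => simpa [pow_succ] using ih.mul hf

/-- **Division**: if `d · c = b` with `b, c` qualifying and `c(0)` a unit of `S`, then `d`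
qualifies (`d' c = b' - d c'`, induction). [folklore] -/
theorem IsDerivConstIn.of_mul_eq {n : ℕ} {b c d : K⟦X⟧} (hb : IsDerivConstIn S n b)
    (hc : IsDerivConstIn S n c) {u : K} (hu : u ∈ S) (huc : u * constantCoeff c = 1)
    (h : d * c = b) : IsDerivConstIn S n d := by
  have h0 : ∀ {b d : K⟦X⟧}, d * c = b → constantCoeff d = u * constantCoeff b := by
    intro b d h
    rw [← h, map_mul]
    linear_combination (-constantCoeff d) * huc
  induction n generalizing b d with
  | zero =>
    rw [isDerivConstIn_zero_iff, h0 h]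
    exact S.mul_mem hu hb
  | succ n ih =>
    refine ⟨?_, ?_⟩
    · rw [h0 h]
      exact S.mul_mem hu hb.1
    · have hd : IsDerivConstIn S n d := ih hb.mono hc.mono h
      have h' : d⁄dX K d * c = d⁄dX K b - d * d⁄dX K c := by
        have := congrArg (d⁄dX K) h
        rw [Derivation.leibniz, smul_eq_mul, smul_eq_mul] at this
        linear_combination this
      exact ih (hb.2.sub (hd.mul hc.2)) hc.mono h'

/-- `(f ∘ g)(0) = f(0)` when `g(0) = 0`. [folklore] -/
theorem constantCoeff_subst_of_constantCoeff_eq_zero {f g : K⟦X⟧} (hg : constantCoeff g = 0) :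
    constantCoeff (f.subst g) = constantCoeff f := by
  rw [← coeff_zero_eq_constantCoeff_apply, coeff_subst' (HasSubst.of_constantCoeff_zero' hg),
    finsum_eq_single _ 0 fun d hd => ?_]
  · simp
  · simp [coeff_zero_eq_constantCoeff_apply, map_pow, hg, zero_pow hd]

/-- **Substitution** (chain rule): `f, g` qualifying and `g(0) = 0` ⇒ `f ∘ g` qualifies.
[folklore] -/
theorem IsDerivConstIn.subst {n : ℕ} {f g : K⟦X⟧} (hf : IsDerivConstIn S n f)
    (hg : IsDerivConstIn S n g) (hg0 : constantCoeff g = 0) :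
    IsDerivConstIn S n (f.subst g) := by
  induction n generalizing f with
  | zero => simpa [constantCoeff_subst_of_constantCoeff_eq_zero hg0] using hf
  | succ n ih =>
    refine ⟨?_, ?_⟩
    · rw [constantCoeff_subst_of_constantCoeff_eq_zero hg0]
      exact hf.1
    · rw [derivative_subst K (HasSubst.of_constantCoeff_zero' hg0)]
      exact (ih hf.2 hg.mono).mul hg.2

/-- **Compositional inverse** (the induction of AEC IV.5.4): if every derivative of `f` has
constant coefficient in `S`, `f'(0) = coeff 1 f` is a unit of `S`, `g(0) = 0` and `f(g(X)) = X`,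
then every derivative of `g` has constant coefficient in `S` (from `g' · f'(g) = 1`).
[Silverman AEC IV.5.4, proof] [cite: SilvermanAEC2009, IV.5.4] -/
theorem IsDerivConstIn.of_subst_eq_X {f g : K⟦X⟧} (hf : ∀ n, IsDerivConstIn S n f) {u : K}
    (hu : u ∈ S) (hu1 : u * coeff 1 f = 1) (hg0 : constantCoeff g = 0) (hfg : f.subst g = X)
    (n : ℕ) : IsDerivConstIn S n g := by
  induction n with
  | zero => simp [hg0]
  | succ n ih =>
    refine ⟨by simp [hg0], ?_⟩
    have hsub : HasSubst g := HasSubst.of_constantCoeff_zero' hg0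
    have h1 : d⁄dX K g * (d⁄dX K f).subst g = 1 := by
      have := congrArg (d⁄dX K) hfg
      rw [derivative_subst K hsub, derivative_X] at this
      rw [mul_comm]
      exact this
    have hc : IsDerivConstIn S n ((d⁄dX K f).subst g) := (hf (n + 1)).2.subst ih hg0
    have hcc : u * constantCoeff ((d⁄dX K f).subst g) = 1 := by
      rw [constantCoeff_subst_of_constantCoeff_eq_zero hg0, ← coeff_zero_eq_constantCoeff_apply,
        coeff_derivative]
      simpa using hu1
    exact IsDerivConstIn.of_mul_eq (isDerivConstIn_one n) hc hu hcc h1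

/-- `f⁽ⁿ⁾(0) = n! · coeff n f`: the predicate gives `n! · coeff n f ∈ S`. [folklore] -/
theorem IsDerivConstIn.factorial_mul_coeff_mem {n : ℕ} {f : K⟦X⟧} (hf : IsDerivConstIn S n f) :
    (n ! : K) * coeff n f ∈ S := by
  induction n generalizing f with
  | zero => simpa [coeff_zero_eq_constantCoeff_apply] using hf.constantCoeff_mem
  | succ n ih =>
    have h := ih hf.2
    rw [coeff_derivative] at h
    have e : ((n + 1)! : K) * coeff (n + 1) f = (n ! : K) * (coeff (n + 1) f * (n + 1)) := by
      push_cast [Nat.factorial_succ]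
      ring
    rwa [e]

/-- Conversely `k! · coeff k f ∈ S` for all `k` gives the predicate at every order. [folklore] -/
theorem isDerivConstIn_of_factorial_mul_coeff_mem {f : K⟦X⟧}
    (hf : ∀ n, (n ! : K) * coeff n f ∈ S) (n : ℕ) : IsDerivConstIn S n f := by
  induction n generalizing f with
  | zero => simpa [coeff_zero_eq_constantCoeff_apply] using hf 0
  | succ n ih =>
    refine ⟨by simpa [coeff_zero_eq_constantCoeff_apply] using hf 0, ih fun m => ?_⟩
    rw [coeff_derivative]
    have e : (m ! : K) * (coeff (m + 1) f * (m + 1)) = ((m + 1)! : K) * coeff (m + 1) f := by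
      push_cast [Nat.factorial_succ]
      ring
    rw [e]
    exact hf (m + 1)

/-- **Silverman AEC Lemma IV.5.4** (denominators of the compositional inverse). Let `S` be a
subring of a commutative ring `K`, and let `f ∈ K⟦X⟧` have the form `f = Σ (aₙ/n!) Xⁿ` with
`aₙ ∈ S` — precisely, `n! · coeff n f ∈ S` for every `n` — and `a₁ = coeff 1 f` a unit of `S`
(`u · a₁ = 1`, `u ∈ S`). If `g ∈ K⟦X⟧` with `g(0) = 0` satisfies `f(g(X)) = X`, then
`g = Σ (bₙ/n!) Xⁿ` with `bₙ ∈ S`: `n! · coeff n g ∈ S` for every `n`. (AEC assumes `R = S`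
torsion-free and `K = R ⊗ ℚ`, where `g` is the unique inverse of IV.2.4; the differentiation
argument printed there proves the present hypothesis-free form.)
[Silverman AEC IV.5.4] [cite: SilvermanAEC2009, IV.5.4] -/
theorem factorial_mul_coeff_mem_of_subst_eq_X (S : Subring K) {f g : K⟦X⟧}
    (hf : ∀ n, (n ! : K) * coeff n f ∈ S) {u : K} (hu : u ∈ S) (hu1 : u * coeff 1 f = 1)
    (hg0 : constantCoeff g = 0) (hfg : f.subst g = X) (n : ℕ) : (n ! : K) * coeff n g ∈ S :=
  (IsDerivConstIn.of_subst_eq_X (isDerivConstIn_of_factorial_mul_coeff_mem hf) hu hu1 hg0 hfg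
    n).factorial_mul_coeff_mem

end Denominators

/-! ### `p`-adic convergence of `Σ (bₙ/n!) tⁿ` for `v(t) > 1/(p-1)` -/

section Padic

variable {p : ℕ} [hp : Fact p.Prime]

/-- **AEC IV.6.2** (weak form, `v(p) = 1`): `v_p(n!) ≤ n/(p - 1)`, from Legendre's formula
`(p - 1) v_p(n!) = n - s_p(n)`. [Silverman AEC IV.6.2] [cite: SilvermanAEC2009, IV.6.2] -/
theorem padicValNat_factorial_le_div (n : ℕ) :
    (padicValNat p n ! : ℝ) ≤ n / ((p : ℝ) - 1) := by
  have hp1 : (1 : ℝ) < p := by exact_mod_cast hp.out.one_lt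
  have h : (p - 1) * padicValNat p n ! ≤ n := by
    rw [sub_one_mul_padicValNat_factorial n]
    exact Nat.sub_le _ _
  have h' : ((p : ℝ) - 1) * padicValNat p n ! ≤ n := by
    have hcast : (((p - 1 : ℕ) : ℝ)) = (p : ℝ) - 1 := by
      rw [Nat.cast_sub hp.out.one_le, Nat.cast_one]
    rw [← hcast]
    exact_mod_cast h
  rw [le_div_iff₀ (by linarith), mul_comm]
  exact h'

/-- `‖n!‖_p = p^{-v_p(n!)} ≥ p^{-n/(p-1)}`, stated as `‖n!‖_p⁻¹ ≤ (p^{1/(p-1)})ⁿ`.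
[Silverman AEC IV.6.2] [cite: SilvermanAEC2009, IV.6.2] -/
theorem inv_norm_factorial_le_rpow (n : ℕ) :
    ‖((n ! : ℕ) : ℚ_[p])‖⁻¹ ≤ ((p : ℝ) ^ (1 / ((p : ℝ) - 1))) ^ n := by
  have hp1 : (1 : ℝ) < p := by exact_mod_cast hp.out.one_lt
  have hp0 : (0 : ℝ) < p := by positivity
  have hfact : ((n ! : ℕ) : ℚ_[p]) ≠ 0 := by exact_mod_cast (Nat.factorial_pos n).ne'
  rw [Padic.norm_eq_zpow_neg_valuation hfact, Padic.valuation_natCast, zpow_neg, inv_inv,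
    zpow_natCast, ← Real.rpow_natCast _ n, ← Real.rpow_mul hp0.le, ← Real.rpow_natCast]
  refine Real.rpow_le_rpow_of_exponent_le hp1.le ?_
  rw [one_div_mul_eq_div]
  exact padicValNat_factorial_le_div n

/-- **AEC IV.6.3(b)** over `ℚ_p` (`v(p) = 1`): if `g = Σ cₙ Tⁿ` has `‖n! · cₙ‖_p ≤ 1`
(`cₙ = bₙ/n!`, `bₙ ∈ ℤ_p`) and `‖t‖_p < p^{-1/(p-1)}` (`v(t) > v(p)/(p - 1)`), then `g(t)`
converges: `‖cₙ tⁿ‖ ≤ (p^{1/(p-1)} ‖t‖)ⁿ`, a geometric series of ratio `< 1`.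
[Silverman AEC IV.6.3(b)] [cite: SilvermanAEC2009, IV.6.3] -/
theorem padic_summable_of_norm_factorial_mul_le {c : ℕ → ℚ_[p]}
    (hc : ∀ n, ‖((n ! : ℕ) : ℚ_[p]) * c n‖ ≤ 1) {t : ℚ_[p]}
    (ht : ‖t‖ < (p : ℝ) ^ (-(1 / ((p : ℝ) - 1)))) :
    Summable fun n : ℕ => c n * t ^ n := by
  have hp1 : (1 : ℝ) < p := by exact_mod_cast hp.out.one_lt
  have hp0 : (0 : ℝ) < p := by positivity
  set ρ : ℝ := (p : ℝ) ^ (1 / ((p : ℝ) - 1)) with hρ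
  have hρ0 : 0 < ρ := Real.rpow_pos_of_pos hp0 _
  have hr1 : ρ * ‖t‖ < 1 := by
    rw [Real.rpow_neg hp0.le] at ht
    calc ρ * ‖t‖ < ρ * ρ⁻¹ := by gcongr
      _ = 1 := mul_inv_cancel₀ hρ0.ne'
  have hr0 : 0 ≤ ρ * ‖t‖ := by positivity
  refine Summable.of_norm_bounded (summable_geometric_of_lt_one hr0 hr1) fun n => ?_
  have hfact : ((n ! : ℕ) : ℚ_[p]) ≠ 0 := by exact_mod_cast (Nat.factorial_pos n).ne'
  have hcn : ‖c n‖ ≤ ρ ^ n := by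
    have hpos : 0 < ‖((n ! : ℕ) : ℚ_[p])‖ := norm_pos_iff.2 hfact
    have h1 : ‖c n‖ ≤ ‖((n ! : ℕ) : ℚ_[p])‖⁻¹ :=
      calc ‖c n‖ = ‖((n ! : ℕ) : ℚ_[p])‖⁻¹ * ‖((n ! : ℕ) : ℚ_[p]) * c n‖ := by
            rw [norm_mul, ← mul_assoc, inv_mul_cancel₀ hpos.ne', one_mul]
        _ ≤ ‖((n ! : ℕ) : ℚ_[p])‖⁻¹ * 1 := by gcongr; exact hc n
        _ = ‖((n ! : ℕ) : ℚ_[p])‖⁻¹ := mul_one _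
    exact h1.trans (inv_norm_factorial_le_rpow n)
  rw [norm_mul, norm_pow, mul_pow]
  gcongr

end Padic

end Literature.NumberTheory.EllipticCurves
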